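import Mathlib
import Summits.CriticalPhenomena.SAWScalingLimit.Theorems.ObservableToSLE.Negative.Identification
import Literature.Probability.Percolation.SlabGluing

/-!
# A compact container for rescaled hexagonal SAW curves (support lemmas for crux `ObservableToSLE`,
stmt-CriticalPhenomena-10472, obstruction W5 "tightness is necessary")

Refuter (cdisprove gen 3) support lemmas, used by `Negative.TightnessNecessity`:

* `dist_polyline_map_le` — polylines through pointwise `ε`-close vertex lists are `ε`-close in
  sup distance (induction over `Path.segment`/`Path.trans`);
* `continuous_mk_polyline` — the curve class of the rescaled polyline of a FIXED honeycomb
  support is (Lipschitz-)continuous in the mesh `δ`;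
* `exists_isCompact_forall_curve_mem` — for meshes in `[lo, hi]`, `0 < lo`, ALL curve classes of
  all nontrivial hexagonal SAWs of a bounded domain lie in ONE compact subset of `CurveClass ℂ`
  (finitely many self-avoiding supports over a finite vertex set);
* `exists_urysohn_infDist`, `integral_urysohn_le`, `measureReal_preimage_le_integral` — the
  Urysohn test function `min 1 (infDist · K / η)` and the two integral inequalities turning
  convergence in law into eventual smallness of `P(curve ∉ K^η)`.
-/

noncomputable section

open Literature.Probability.RandomPlanarGeometry Literature.Probability.RandomPlanarGeometry.SAW
  Literature.Probability.LatticeModels Literature.Probability MeasureTheory Filter Topology Set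
open scoped NNReal ENNReal BoundedContinuousFunction

namespace Summit.CriticalPhenomena.SAWScalingLimit.Theorems.ObservableToSLE.Negative

/-! ### Polylines depend Lipschitz-continuously on their vertices -/

section Polyline

variable {V E : Type*} [NormedAddCommGroup E] [NormedSpace ℝ E]

/-- Two points on corresponding segments are no further apart than the endpoints. [folklore] -/
theorem dist_lineMap_lineMap_le {a b a' b' : E} {ε r : ℝ} (hr0 : 0 ≤ r) (hr1 : r ≤ 1)
    (ha : dist a a' ≤ ε) (hb : dist b b' ≤ ε) :
    dist (AffineMap.lineMap a b r) (AffineMap.lineMap a' b' r) ≤ ε := by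
  rw [AffineMap.lineMap_apply_module, AffineMap.lineMap_apply_module]
  calc dist ((1 - r) • a + r • b) ((1 - r) • a' + r • b')
      ≤ dist ((1 - r) • a) ((1 - r) • a') + dist (r • b) (r • b') := dist_add_add_le _ _ _ _
    _ = (1 - r) * dist a a' + r * dist b b' := by
        rw [dist_smul₀, dist_smul₀, Real.norm_of_nonneg (by linarith), Real.norm_of_nonneg hr0]
    _ ≤ (1 - r) * ε + r * ε :=
        add_le_add (mul_le_mul_of_nonneg_left ha (by linarith)) (mul_le_mul_of_nonneg_left hb hr0)
    _ = ε := by ring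

/-- Polylines through pointwise `ε`-close vertex lists are pointwise `ε`-close (same
combinatorics `a :: l`, two embeddings `f`, `g`). [folklore] -/
theorem dist_polylineFrom_apply_le (f g : V → E) {ε : ℝ} :
    ∀ (l : List V) (a : V), (∀ v ∈ a :: l, dist (f v) (g v) ≤ ε) →
      ∀ t, dist ((polylineFrom (f a) (l.map f)).2 t) ((polylineFrom (g a) (l.map g)).2 t) ≤ ε := by
  intro l
  induction l with
  | nil =>
    intro a h t
    show dist (f a) (g a) ≤ ε
    exact h a (by simp)
  | cons b l ih =>
    intro a h t
    have ha : dist (f a) (g a) ≤ ε := h a (by simp)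
    have hb : dist (f b) (g b) ≤ ε := h b (by simp)
    have htail : ∀ v ∈ b :: l, dist (f v) (g v) ≤ ε := fun v hv => h v (List.mem_cons_of_mem _ hv)
    show dist (((Path.segment (f a) (f b)).trans (polylineFrom (f b) (l.map f)).2) t)
      (((Path.segment (g a) (g b)).trans (polylineFrom (g b) (l.map g)).2) t) ≤ ε
    rw [Path.trans_apply, Path.trans_apply]
    split_ifs with h1
    · rw [Path.segment_apply, Path.segment_apply]
      refine dist_lineMap_lineMap_le ?_ ?_ ha hb
      · exact mul_nonneg (by norm_num) t.2.1
      · linarith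
    · exact ih b htail _

/-- Sup-distance form: the polylines (as continuous maps on `[0,1]`) through `l.map f` and
`l.map g` are `ε`-close whenever `f` and `g` are `ε`-close on `l`. [folklore] -/
theorem dist_polyline_map_le (f g : V → E) {ε : ℝ} (hε : 0 ≤ ε) (l : List V)
    (h : ∀ v ∈ l, dist (f v) (g v) ≤ ε) :
    dist (polyline (l.map f)) (polyline (l.map g)) ≤ ε := by
  rw [ContinuousMap.dist_le hε]
  intro t
  cases l with
  | nil => simpa using hε
  | cons a l =>
    show dist ((polylineFrom (f a) (l.map f)).2 t) ((polylineFrom (g a) (l.map g)).2 t) ≤ ε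
    exact dist_polylineFrom_apply_le f g l a h t

end Polyline

/-! ### Rescaled hexagonal polylines: continuity in the mesh and a compact container -/

/-- The curve of a hexagonal SAW is the curve class of the rescaled polyline through its
support. [folklore] -/
theorem curve_eq_mk_polyline {Ω : Set ℂ} {δ : ℝ} {u v : HexVertex} (γ : HexDomainSAW Ω δ u v) :
    γ.curve = CurveClass.mk ⟨polyline (γ.walk.support.map fun w => (δ : ℂ) * hexCenter w)⟩ :=
  rfl

/-- The rescaled polyline of a fixed vertex list moves Lipschitz-continuously with the mesh. [folklore] -/
theorem dist_mk_polyline_le (δ δ' : ℝ) (l : List HexVertex) :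
    dist (CurveClass.mk ⟨polyline (l.map fun w => (δ : ℂ) * hexCenter w)⟩)
        (CurveClass.mk ⟨polyline (l.map fun w => (δ' : ℂ) * hexCenter w)⟩) ≤
      dist δ δ' * ∑ v ∈ l.toFinset, ‖hexCenter v‖ := by
  rw [CurveClass.dist_mk_mk]
  refine (Curve.dist_le_dist_toContinuousMap _ _).trans ?_
  refine dist_polyline_map_le _ _ (by positivity) l fun v hv => ?_
  rw [dist_eq_norm, ← sub_mul, norm_mul, ← dist_eq_norm, Complex.dist_eq, ← Complex.ofReal_sub,
    Complex.norm_real, Real.norm_eq_abs, ← Real.dist_eq]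
  refine mul_le_mul_of_nonneg_left ?_ dist_nonneg
  exact Finset.single_le_sum (f := fun v => ‖hexCenter v‖) (fun _ _ => norm_nonneg _)
    (List.mem_toFinset.2 hv)

/-- Continuity of the rescaled polyline in the mesh. [folklore] -/
theorem continuous_mk_polyline (l : List HexVertex) :
    Continuous fun δ : ℝ => CurveClass.mk ⟨polyline (l.map fun w => (δ : ℂ) * hexCenter w)⟩ := by
  set M : ℝ := ∑ v ∈ l.toFinset, ‖hexCenter v‖ with hM
  have hM0 : 0 ≤ M := Finset.sum_nonneg fun _ _ => norm_nonneg _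
  refine Metric.continuous_iff.2 fun δ ε hε => ⟨ε / (M + 1), by positivity, fun δ' hδ' => ?_⟩
  calc dist (CurveClass.mk ⟨polyline (l.map fun w => (δ' : ℂ) * hexCenter w)⟩)
        (CurveClass.mk ⟨polyline (l.map fun w => (δ : ℂ) * hexCenter w)⟩)
        ≤ dist δ' δ * M := dist_mk_polyline_le δ' δ l
    _ ≤ ε / (M + 1) * M := mul_le_mul_of_nonneg_right hδ'.le hM0
    _ < ε := by
        rw [div_mul_eq_mul_div, div_lt_iff₀ (by positivity)]
        nlinarith


/-- For meshes in `[lo, hi]`, `0 < lo`, the mesh vertices of a bounded domain lie in one finite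
set of honeycomb vertices. [folklore] -/
theorem exists_finite_superset_embMeshVertices {Ω : Set ℂ} (hΩ : Bornology.IsBounded Ω) {lo : ℝ}
    (hlo : 0 < lo) :
    ∃ S : Set HexVertex, S.Finite ∧ ∀ δ, lo ≤ δ → embMeshVertices hexCenter Ω δ ⊆ S := by
  obtain ⟨R, hR⟩ := hΩ.subset_ball 0
  refine ⟨embMeshVertices hexCenter (Metric.ball (0 : ℂ) (R / lo)) 1,
    finite_embMeshVertices_hex Metric.isBounded_ball one_ne_zero, fun δ hδ v hv => ?_⟩
  have hδ0 : 0 < δ := hlo.trans_le hδ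
  have h := hR hv
  rw [Metric.mem_ball, dist_zero_right, norm_mul, Complex.norm_real, Real.norm_eq_abs,
    abs_of_pos hδ0] at h
  show ((1 : ℝ) : ℂ) * hexCenter v ∈ Metric.ball (0 : ℂ) (R / lo)
  rw [Complex.ofReal_one, one_mul, Metric.mem_ball, dist_zero_right, lt_div_iff₀ hlo]
  calc ‖hexCenter v‖ * lo ≤ ‖hexCenter v‖ * δ := mul_le_mul_of_nonneg_left hδ (norm_nonneg _)
    _ = δ * ‖hexCenter v‖ := mul_comm _ _
    _ < R := h

/-- Every vertex of a NONTRIVIAL walk of `Ω_δ` is a mesh vertex of `Ω`. [folklore] -/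
theorem mem_embMeshVertices_of_mem_support {V : Type*} {G : SimpleGraph V} {emb : V → ℂ}
    {Ω : Set ℂ} {δ : ℝ} {u v : V} (huv : u ≠ v) (p : (embDomainGraph G emb Ω δ).Walk u v) {w : V}
    (hw : w ∈ p.support) : w ∈ embMeshVertices emb Ω δ := by
  cases p with
  | nil => exact absurd rfl huv
  | cons hadj p' =>
    rw [SimpleGraph.Walk.support_cons, List.mem_cons] at hw
    rcases hw with rfl | hw
    · exact embMeshDomain_subset G emb Ω δ ((embDomainGraph_adj_iff G emb).1 hadj).2.1
    · exact embMeshDomain_subset G emb Ω δ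
        (mem_embMeshDomain_of_mem_support_tail (SimpleGraph.Walk.cons hadj p') hw)

/-- COMPACT CONTAINER: for meshes in a compact interval `[lo, hi] ⊆ (0, ∞)` all curve classes of
all nontrivial hexagonal SAWs of a bounded domain lie in ONE compact subset of `CurveClass ℂ`
(finitely many combinatorial supports, each moving continuously with the mesh). [folklore] -/
theorem exists_isCompact_forall_curve_mem {Ω : Set ℂ} (hΩ : Bornology.IsBounded Ω) {lo hi : ℝ}
    (hlo : 0 < lo) :
    ∃ C : Set (CurveClass ℂ), IsCompact C ∧ ∀ δ ∈ Set.Icc lo hi, ∀ (u v : HexVertex), u ≠ v →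
      ∀ γ : HexDomainSAW Ω δ u v, γ.curve ∈ C := by
  obtain ⟨S, hS, hsub⟩ := exists_finite_superset_embMeshVertices hΩ hlo
  set L : Set (List HexVertex) := {l | l.Nodup ∧ ∀ x ∈ l, x ∈ S} with hL
  have hLfin : L.Finite := Literature.Probability.Percolation.finite_setOf_nodup_subset hS
  refine ⟨⋃ l ∈ L, (fun δ : ℝ => CurveClass.mk ⟨polyline (l.map fun w => (δ : ℂ) * hexCenter w)⟩) ''
      Set.Icc lo hi,
    hLfin.isCompact_biUnion fun l _ => isCompact_Icc.image (continuous_mk_polyline l), ?_⟩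
  intro δ hδ u v huv γ
  rw [curve_eq_mk_polyline]
  refine Set.mem_biUnion (x := γ.walk.support) ⟨γ.isPath.support_nodup, fun x hx => ?_⟩
    ⟨δ, hδ, rfl⟩
  exact hsub δ hδ.1 (mem_embMeshVertices_of_mem_support huv γ.walk hx)

/-! ### A Urysohn test function per compact set and scale -/

/-- `g_{K,η}(x) = min 1 (infDist x K / η)`: bounded continuous, `0` on `K`, `1` at distance
`≥ η` from `K`, values in `[0, 1]`. [folklore] -/
theorem exists_urysohn_infDist (K : Set (CurveClass ℂ)) {η : ℝ} (hη : 0 < η) :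
    ∃ g : CurveClass ℂ →ᵇ ℝ, (∀ x, 0 ≤ g x) ∧ (∀ x, g x ≤ 1) ∧ (∀ x ∈ K, g x = 0) ∧
      ∀ x, η ≤ Metric.infDist x K → g x = 1 := by
  refine ⟨BoundedContinuousFunction.mkOfBound
    ⟨fun x => min 1 (Metric.infDist x K / η),
      continuous_const.min ((Metric.continuous_infDist_pt K).div_const η)⟩ 1 ?_, ?_, ?_, ?_, ?_⟩
  · intro x y
    simp only [ContinuousMap.coe_mk, Real.dist_eq]
    have hx0 : 0 ≤ min 1 (Metric.infDist x K / η) :=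
      le_min zero_le_one (div_nonneg Metric.infDist_nonneg hη.le)
    have hy0 : 0 ≤ min 1 (Metric.infDist y K / η) :=
      le_min zero_le_one (div_nonneg Metric.infDist_nonneg hη.le)
    have hx1 : min 1 (Metric.infDist x K / η) ≤ 1 := min_le_left _ _
    have hy1 : min 1 (Metric.infDist y K / η) ≤ 1 := min_le_left _ _
    rw [abs_sub_le_iff]
    constructor <;> linarith
  · intro x
    exact le_min zero_le_one (div_nonneg Metric.infDist_nonneg hη.le)
  · intro x
    exact min_le_left _ _
  · intro x hx
    show min 1 (Metric.infDist x K / η) = 0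
    rw [Metric.infDist_zero_of_mem hx, zero_div]
    simp
  · intro x hx
    show min 1 (Metric.infDist x K / η) = 1
    exact min_eq_left ((one_le_div hη).2 hx)

/-- `∫ g dμ ≤ μ(Kᶜ)` when `g ≤ 1` vanishes on the closed set `K` (probability measure). [folklore] -/
theorem integral_urysohn_le {μ : Measure (CurveClass ℂ)} [IsProbabilityMeasure μ]
    {K : Set (CurveClass ℂ)} (hK : IsClosed K) {g : CurveClass ℂ →ᵇ ℝ}
    (h1 : ∀ x, g x ≤ 1) (hK0 : ∀ x ∈ K, g x = 0) :
    ∫ x, g x ∂μ ≤ μ.real Kᶜ := by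
  rw [← integral_indicator_one hK.measurableSet.compl]
  refine integral_mono (g.integrable μ) ((integrable_const (1 : ℝ)).indicator
    hK.measurableSet.compl) fun x => ?_
  by_cases hx : x ∈ K
  · simp [hx, hK0 x hx]
  · simp [hx, h1 x]

/-- `P(Y ∈ F) ≤ ∫ g ∘ Y dP` when `g ≥ 0` equals `1` on `F` (probability measure, `Y`
measurable). [folklore] -/
theorem measureReal_preimage_le_integral {α : Type*} [MeasurableSpace α] {P : Measure α}
    [IsProbabilityMeasure P] {Y : α → CurveClass ℂ} (hY : Measurable Y)
    {F : Set (CurveClass ℂ)} (hF : MeasurableSet F) {g : CurveClass ℂ →ᵇ ℝ}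
    (h0 : ∀ x, 0 ≤ g x) (hF1 : ∀ x ∈ F, g x = 1) :
    P.real (Y ⁻¹' F) ≤ ∫ ω, g (Y ω) ∂P := by
  rw [← integral_indicator_one (hY hF)]
  have hint : Integrable (fun ω => g (Y ω)) P :=
    Integrable.of_bound (g.continuous.measurable.comp hY).aestronglyMeasurable ‖g‖
      (Eventually.of_forall fun ω => g.norm_coe_le_norm (Y ω))
  refine integral_mono ((integrable_const (1 : ℝ)).indicator (hY hF)) hint fun ω => ?_
  by_cases hω : Y ω ∈ F
  · have : ω ∈ Y ⁻¹' F := hω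
    simp [this, hF1 _ hω]
  · have : ω ∉ Y ⁻¹' F := hω
    simp [this, h0]

end Summit.CriticalPhenomena.SAWScalingLimit.Theorems.ObservableToSLE.Negative
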